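/-
Copyright: seat `ym-line-cbag-p2` (prover-ym-line-cbag-p2-g0-0), route `ColdBoxAllGroups`, crux `BulkAllGroups`
(stmt-QuantumFields-22255), line `dlr-chessboard-G` (skeleton `Cruxes/BulkAllGroups/Lines/birth.lean`).
-/
import Summits.QuantumFields.YangMills.Theorems.ColdBoxAllGroupsDefs
import Summits.QuantumFields.YangMills.Theorems.WeakCouplingRatesBulkDominatesColdBoxWDlrPlumbing
import Literature.MathematicalPhysics.QuantumFieldTheory.CloverStressTensor
import Literature.MathematicalPhysics.QuantumFieldTheory.BalabanBlockSpecification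

/-!
# Registered stub L3-G `stub_dlrAssemblyG : DlrAssemblyG` of crux `BulkAllGroups` (stmt-QuantumFields-22255) —
# the DLR law of total covariance through the cold box for EVERY compact gauge group.
# Part 1 of 2: PLUMBING (plaquette costs for a unitary `ρ`, the bad set, the torus covariance through the box kernels);
# part 2 (`ColdBoxAllGroupsBulkAllGroupsStubDlrAssemblyG`) proves the stub by name.

WHAT.  `DlrAssemblyG` (module `ColdBoxAllGroupsDefs`, the line's L3-G): for every compact group `G` (Borel structure an instance),
every faithful continuous unitary `r : LatticeRep G` and all real `A θ δ η₁ K` with `0 < A`, `0 < δ`, `0 < η₁` and the window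
`K + 4δ + 2A < 2 + 2θ`,
`GoodBoundaryCovStableG r.ρ A θ δ η₁ → GoodBoundaryMeanSmoothG r.ρ A θ δ → PlaquetteLargeFieldRarityG r.ρ δ → BoxPolyFloorG r.ρ A θ K →
BulkDominatesBox r.ρ A θ`.  PROVED in part 2 (`stub_dlrAssemblyG`) with `η = η₁/2` — the G-port of the `SU(2)` stub `stub_dlrAssembly`
(`WeakCouplingRatesBulkDominatesColdBoxWStubDlrAssembly`, p448414), whose proof is generic in the group but typed for `SU(2)`; this part
supplies:

* §1 the plaquette cost `plaqCostAt ρ x i j` for a unitary `ρ` of degree `N`: cylinder, continuous, measurable, `|c| ≤ 2N`;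
  `G` is second countable (tree `LatticeRep.secondCountableTopology`);
* §2 the bad boundary data `Bad = ⋃_{x ∈ [−1,2H+1]⁴, i<j} {β^{2δ−1} < c_{x,ij}}` (finite union, measurable), off which the lifted datum is
  `CrudeGoodG`, and whose torus mass is `≤ 6(2H+3)⁴ e^{−β^δ}` by the union bound and L2-G (`measureReal_badSetG_le`);
* §3 `torusPlaqCov_eq_boxKernelG` — for torus sides `L+1 > 2(2H+T+2)` the leaf's origin-based torus covariance `torusPlaqCov ρ β L T 1 2`
  equals `∫ q − ∫ h · ∫ k` with `h, k, q` the box-kernel means of `c_p`, `c_{p'}`, `c_p c_{p'}` (`p = (boxCentre H; 1,2)`, `p' = p + Te₀`) at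
  the periodic lift: translation invariance (`integral_comp_configShift_torusLift`) + the DLR equations
  (`wilsonExpectation_toTorusObservable_eq`, torus fit `fst_mem_box_of_mem_boxUnion` of the `SU(2)` plumbing file, which is group-free);
* §4 `boxPlaqCov_le_sq` — `boxPlaqCov ρ β H T ≤ 8N²`;
(part 2, `stub_dlrAssemblyG`: the `SU(2)` plumbing file's abstract law of total covariance `total_covariance_lower_bound_sub` with
`K₀ = 2N` and the exceptional event `{lift ∈ Bad}`, then the window arithmetic.)

WHAT THIS IS NOT.  No analysis: L1a-G, L1b-G and `BoxPolyFloorG` (= BOX_G + FLOOR) are hypotheses of `DlrAssemblyG`.  NOT a claim about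
the mass gap (the crux is a rung-level finite-volume comparison; the Yang–Mills mass gap is NOT proved by any of this).

References: H.-O. Georgii, *Gibbs Measures and Phase Transitions* (2011) Prop. 2.5, Thm. 4.17; S. Friedli, Y. Velenik (2017) Lemma 6.7,
(6.34); E. Seiler, LNP 159 (1982) Ch. 2; R. Durrett (2019) §4.1.
-/

set_option autoImplicit false

noncomputable section

open MeasureTheory Filter Topology
open Literature.MathematicalPhysics
open Literature.MathematicalPhysics.QuantumFieldTheory
open Literature.MathematicalPhysics.QuantumLattice
open Literature.Probability.LatticeModels (Torus.proj box mem_box)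
open Summit.QuantumFields.YangMills.Theorems.WeakCouplingRates

namespace Summit.QuantumFields.YangMills.Theorems.ColdBoxAllGroups

/-! ### §1. The plaquette cost for a unitary representation of degree `N` -/

section Cost

variable {N : ℕ} {G : Type*} [Group G] [TopologicalSpace G] [IsTopologicalGroup G] [CompactSpace G]
  [MeasurableSpace G] [BorelSpace G]
variable (ρ : G →* Matrix (Fin N) (Fin N) ℂ)

omit [TopologicalSpace G] [IsTopologicalGroup G] [CompactSpace G] [MeasurableSpace G] [BorelSpace G] in
/-- The plaquette cost `plaqCostAt ρ x 1 2` is a cylinder observable on the four edges of `(x; 1, 2)`. [folklore] -/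
theorem isCylinder_plaqCostAt12G (x : Literature.Probability.LatticeModels.Site 4) :
    IsCylinder (plaqCostAt ρ x 1 2) (plaquetteEdges ((x, ⟨(1, 2), by decide⟩) : ZdPlaquette 4)) := by
  intro U V hUV
  have h := isCylinder_plaquetteObs (G := G) ρ ((x, ⟨(1, 2), by decide⟩) : ZdPlaquette 4) hUV
  simp only [plaqCostAt]
  exact congrArg (fun r : ℝ => (N : ℝ) - r) h

omit [CompactSpace G] [MeasurableSpace G] [BorelSpace G] in
/-- `plaqCostAt ρ x i j` is continuous for a continuous `ρ`. [folklore] -/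
theorem continuous_plaqCostAtG (hρ : Continuous ρ) (x : Literature.Probability.LatticeModels.Site 4) (i j : Fin 4) :
    Continuous (plaqCostAt ρ x i j) := by
  show Continuous fun U : LGConfig 4 G => (N : ℝ) - plaquetteObs ρ x i j U
  exact continuous_const.sub (continuous_plaquetteObs _ hρ x i j)

omit [CompactSpace G] in
/-- `plaqCostAt ρ x i j` is measurable (continuous `ρ`, second-countable `G`). [folklore] -/
theorem measurable_plaqCostAtG [SecondCountableTopology G] (hρ : Continuous ρ)
    (x : Literature.Probability.LatticeModels.Site 4) (i j : Fin 4) : Measurable (plaqCostAt ρ x i j) :=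
  (continuous_plaqCostAtG ρ hρ x i j).measurable

omit [TopologicalSpace G] [IsTopologicalGroup G] [CompactSpace G] [MeasurableSpace G] [BorelSpace G] in
/-- `|plaqCostAt ρ x i j| ≤ 2N` for a unitary `ρ` (`|Re tr ρ(U)| ≤ N`). [folklore] -/
theorem abs_plaqCostAt_leG (hρu : ∀ g, ρ g ∈ Matrix.unitaryGroup (Fin N) ℂ) (x : Literature.Probability.LatticeModels.Site 4)
    (i j : Fin 4) (U : LGConfig 4 G) : |plaqCostAt ρ x i j U| ≤ 2 * N := by
  have h := abs_plaquetteObs_le_holds (G := G) ρ hρu x i j U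
  simp only [plaqCostAt] at h ⊢
  have h1 := abs_sub (N : ℝ) (plaquetteObs ρ x i j U)
  rw [Nat.abs_cast] at h1
  linarith

omit [TopologicalSpace G] [IsTopologicalGroup G] [CompactSpace G] [MeasurableSpace G] [BorelSpace G] in
/-- Products of two plaquette costs are bounded by `(2N)²`. [folklore] -/
theorem abs_plaqCostAt_mul_leG (hρu : ∀ g, ρ g ∈ Matrix.unitaryGroup (Fin N) ℂ) (x y : Literature.Probability.LatticeModels.Site 4)
    (i j : Fin 4) (U : LGConfig 4 G) : |plaqCostAt ρ x i j U * plaqCostAt ρ y i j U| ≤ (2 * N) ^ 2 := by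
  rw [abs_mul, sq]
  exact mul_le_mul (abs_plaqCostAt_leG ρ hρu x i j U) (abs_plaqCostAt_leG ρ hρu y i j U) (abs_nonneg _) (by positivity)

end Cost

/-! ### §2. The bad boundary data: a finite union of single-plaquette large-field events -/

section Bad

variable {N : ℕ} {G : Type*} [Group G] [TopologicalSpace G] [IsTopologicalGroup G] [CompactSpace G]
  [MeasurableSpace G] [BorelSpace G]
variable (ρ : G →* Matrix (Fin N) (Fin N) ℂ)

omit [TopologicalSpace G] [IsTopologicalGroup G] [CompactSpace G] [MeasurableSpace G] [BorelSpace G] in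
/-- Off the bad set the datum is crude-good. [folklore] -/
theorem crudeGoodG_of_not_mem_badSet {β δ : ℝ} {H : ℕ} {W : LGConfig 4 G}
    (hW : W ∉ ⋃ z ∈ (Fintype.piFinset fun _ : Fin 4 => Finset.Icc (-1 : ℤ) (2 * (H : ℤ) + 1)) ×ˢ
        ((Finset.univ : Finset (Fin 4 × Fin 4)).filter fun q => q.1 < q.2),
      {W : LGConfig 4 G | β ^ (2 * δ - 1) < plaqCostAt ρ z.1 z.2.1 z.2.2 W}) :
    CrudeGoodG ρ β δ H W := by
  intro x hx i j hij
  by_contra hlt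
  rw [not_le] at hlt
  refine hW (Set.mem_iUnion₂.2 ⟨(x, (i, j)), ?_, hlt⟩)
  exact Finset.mem_product.2 ⟨by simpa [Fintype.mem_piFinset] using hx, by simpa using hij⟩

omit [CompactSpace G] in
/-- The bad set is measurable. [folklore] -/
theorem measurableSet_badSetG [SecondCountableTopology G] (hρ : Continuous ρ) (β δ : ℝ) (H : ℕ) :
    MeasurableSet (⋃ z ∈ (Fintype.piFinset fun _ : Fin 4 => Finset.Icc (-1 : ℤ) (2 * (H : ℤ) + 1)) ×ˢ
        ((Finset.univ : Finset (Fin 4 × Fin 4)).filter fun q => q.1 < q.2),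
        {W : LGConfig 4 G | β ^ (2 * δ - 1) < plaqCostAt ρ z.1 z.2.1 z.2.2 W}) :=
  Finset.measurableSet_biUnion _ fun z _ => measurableSet_lt measurable_const (measurable_plaqCostAtG ρ hρ z.1 z.2.1 z.2.2)

/-- The torus mass of a single-plaquette large-field event, read through the periodic lift, is the Wilson expectation of the
indicator observable of the line's predicate `PlaquetteLargeFieldRarityG`. [folklore] -/
theorem measureReal_setOf_le_plaqCostAt_eqG [SecondCountableTopology G] (hρ : Continuous ρ) (β t : ℝ) (L : ℕ)
    (x : Literature.Probability.LatticeModels.Site 4) (i j : Fin 4) :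
    (wilsonMeasure (d := 4) (L := L + 1) ρ β).real
        {U : GaugeConfig 4 (L + 1) G | t ≤ plaqCostAt ρ x i j (torusLift (L + 1) U)} =
      wilsonExpectation (L := L + 1) ρ β
        (toTorusObservable (L + 1) fun U : LGConfig 4 G => if t ≤ plaqCostAt ρ x i j U then (1 : ℝ) else 0) := by
  have hSm : MeasurableSet {U : GaugeConfig 4 (L + 1) G | t ≤ plaqCostAt ρ x i j (torusLift (L + 1) U)} :=
    measurableSet_le measurable_const ((measurable_plaqCostAtG ρ hρ x i j).comp (measurable_torusLift _))
  rw [← integral_indicator_one hSm]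
  unfold wilsonExpectation
  congr 1

/-- **Union bound for the bad set.** If every single-plaquette large-field indicator has Wilson expectation `≤ e^{−β^δ}` on the torus
`(L+1)⁴` (the line's L2-G at this `β` and `L`), the lifted bad set has torus mass `≤ 6(2H+3)⁴ e^{−β^δ}` — uniformly in `L`. [folklore] -/
theorem measureReal_badSetG_le [SecondCountableTopology G] (hρ : Continuous ρ) {β δ : ℝ} {H L : ℕ}
    (hL2 : ∀ (x : Literature.Probability.LatticeModels.Site 4) (i j : Fin 4), i < j →
      wilsonExpectation (L := L + 1) ρ β
          (toTorusObservable (L + 1) fun U : LGConfig 4 G =>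
            if β ^ (2 * δ - 1) ≤ plaqCostAt ρ x i j U then (1 : ℝ) else 0) ≤
        Real.exp (-(β ^ δ))) :
    (wilsonMeasure (d := 4) (L := L + 1) ρ β).real
        {U : GaugeConfig 4 (L + 1) G | torusLift (L + 1) U ∈
          (⋃ z ∈ (Fintype.piFinset fun _ : Fin 4 => Finset.Icc (-1 : ℤ) (2 * (H : ℤ) + 1)) ×ˢ
              ((Finset.univ : Finset (Fin 4 × Fin 4)).filter fun q => q.1 < q.2),
            {W : LGConfig 4 G | β ^ (2 * δ - 1) < plaqCostAt ρ z.1 z.2.1 z.2.2 W})} ≤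
      ((6 * (2 * H + 3) ^ 4 : ℕ) : ℝ) * Real.exp (-(β ^ δ)) := by
  haveI := isProbabilityMeasure_wilsonMeasure (d := 4) (L := L + 1) (G := G) ρ hρ β
  set μ := wilsonMeasure (d := 4) (L := L + 1) ρ β with hμ
  have hset : {U : GaugeConfig 4 (L + 1) G | torusLift (L + 1) U ∈
          (⋃ z ∈ (Fintype.piFinset fun _ : Fin 4 => Finset.Icc (-1 : ℤ) (2 * (H : ℤ) + 1)) ×ˢ
              ((Finset.univ : Finset (Fin 4 × Fin 4)).filter fun q => q.1 < q.2),
            {W : LGConfig 4 G | β ^ (2 * δ - 1) < plaqCostAt ρ z.1 z.2.1 z.2.2 W})} =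
      ⋃ z ∈ (Fintype.piFinset fun _ : Fin 4 => Finset.Icc (-1 : ℤ) (2 * (H : ℤ) + 1)) ×ˢ
          ((Finset.univ : Finset (Fin 4 × Fin 4)).filter fun q => q.1 < q.2),
        {U : GaugeConfig 4 (L + 1) G | β ^ (2 * δ - 1) < plaqCostAt ρ z.1 z.2.1 z.2.2 (torusLift (L + 1) U)} := by
    ext U
    simp only [Set.mem_setOf_eq, Set.mem_iUnion, exists_prop]
  rw [hset]
  refine (measureReal_biUnion_finset_le _ _).trans ?_
  have hterm : ∀ z ∈ (Fintype.piFinset fun _ : Fin 4 => Finset.Icc (-1 : ℤ) (2 * (H : ℤ) + 1)) ×ˢ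
      ((Finset.univ : Finset (Fin 4 × Fin 4)).filter fun q => q.1 < q.2),
      μ.real {U : GaugeConfig 4 (L + 1) G | β ^ (2 * δ - 1) < plaqCostAt ρ z.1 z.2.1 z.2.2 (torusLift (L + 1) U)} ≤
        Real.exp (-(β ^ δ)) := by
    intro z hz
    have hij : z.2.1 < z.2.2 := by
      have := (Finset.mem_product.1 hz).2
      simpa using this
    calc μ.real {U : GaugeConfig 4 (L + 1) G | β ^ (2 * δ - 1) < plaqCostAt ρ z.1 z.2.1 z.2.2 (torusLift (L + 1) U)}
        ≤ μ.real {U : GaugeConfig 4 (L + 1) G | β ^ (2 * δ - 1) ≤ plaqCostAt ρ z.1 z.2.1 z.2.2 (torusLift (L + 1) U)} :=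
          measureReal_mono (fun U (hU : β ^ (2 * δ - 1) < _) => le_of_lt hU)
      _ = _ := measureReal_setOf_le_plaqCostAt_eqG ρ hρ β _ L z.1 z.2.1 z.2.2
      _ ≤ Real.exp (-(β ^ δ)) := hL2 z.1 z.2.1 z.2.2 hij
  refine (Finset.sum_le_sum hterm).trans ?_
  rw [Finset.sum_const, nsmul_eq_mul, Finset.card_product, card_coronaSites, card_planePairs]
  push_cast
  ring_nf
  rfl

end Bad

/-! ### §3. The torus covariance through the box kernels (translation invariance + the DLR equations) -/

section Torus

variable {N : ℕ} {G : Type*} [Group G] [TopologicalSpace G] [IsTopologicalGroup G] [CompactSpace G]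
  [MeasurableSpace G] [BorelSpace G]
variable (ρ : G →* Matrix (Fin N) (Fin N) ℂ)

/-- **The torus two-point function through the box kernels**, any compact `G`. For the torus of side `L+1 > 2(2H+T+2)`, the leaf's
origin-based torus covariance `torusPlaqCov ρ β L T 1 2` equals `∫ q − ∫ h · ∫ k`, where `h, k, q` are the box-kernel
(`ymSpecification ρ β (boxEdges 4 (2H+1)) ·`) means of `c_p`, `c_{p'}`, `c_p c_{p'}` (`p = (boxCentre H; 1,2)`, `p' = p + Te₀`)
evaluated at the periodic lift of the torus configuration (Georgii 2011 Thm. 4.17; Friedli–Velenik 2017 Lemma 6.7). [folklore] -/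
theorem torusPlaqCov_eq_boxKernelG [SecondCountableTopology G] (hρ : Continuous ρ) (hρu : ∀ g, ρ g ∈ Matrix.unitaryGroup (Fin N) ℂ)
    (β : ℝ) {H T L : ℕ} (hL : 2 * (2 * H + T + 2) < L + 1) :
    torusPlaqCov (d := 4) ρ β L T 1 2 =
      (∫ U, (∫ W, plaqCostAt ρ (boxCentre H) 1 2 W * plaqCostAt ρ (boxCentre H + Pi.single 0 (T : ℤ)) 1 2 W
            ∂(ymSpecification (d := 4) ρ β (AxialGauge.boxEdges 4 (2 * H + 1)) (torusLift (L + 1) U)))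
          ∂(wilsonMeasure (d := 4) (L := L + 1) ρ β)) -
        (∫ U, (∫ W, plaqCostAt ρ (boxCentre H) 1 2 W
            ∂(ymSpecification (d := 4) ρ β (AxialGauge.boxEdges 4 (2 * H + 1)) (torusLift (L + 1) U)))
          ∂(wilsonMeasure (d := 4) (L := L + 1) ρ β)) *
        (∫ U, (∫ W, plaqCostAt ρ (boxCentre H + Pi.single 0 (T : ℤ)) 1 2 W
            ∂(ymSpecification (d := 4) ρ β (AxialGauge.boxEdges 4 (2 * H + 1)) (torusLift (L + 1) U)))
          ∂(wilsonMeasure (d := 4) (L := L + 1) ρ β)) := by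
  set bc : Literature.Probability.LatticeModels.Site 4 := boxCentre H with hbc
  set v0 : Literature.Probability.LatticeModels.Site 4 := Pi.single 0 (T : ℤ) with hv0
  set Λ : Finset (QuantumLattice.ZdEdge 4) := AxialGauge.boxEdges 4 (2 * H + 1) with hΛ
  set cp : LGConfig 4 G → ℝ := plaqCostAt ρ bc 1 2 with hcp
  set cp' : LGConfig 4 G → ℝ := plaqCostAt ρ (bc + v0) 1 2 with hcp'
  -- supports and the torus fit
  set S₀ : Finset (QuantumLattice.ZdEdge 4) :=
    plaquetteEdges ((bc, ⟨(1, 2), by decide⟩) : ZdPlaquette 4) ∪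
      plaquetteEdges ((bc + v0, ⟨(1, 2), by decide⟩) : ZdPlaquette 4) with hS₀
  have hcyl : IsCylinder cp S₀ := (isCylinder_plaqCostAt12G ρ bc).mono (Finset.coe_subset.2 Finset.subset_union_left)
  have hcyl' : IsCylinder cp' S₀ := (isCylinder_plaqCostAt12G ρ (bc + v0)).mono (Finset.coe_subset.2 Finset.subset_union_right)
  have hcylq : IsCylinder (fun U => cp U * cp' U) S₀ :=
    IsCylinder.mul (isCylinder_plaqCostAt12G ρ bc) (isCylinder_plaqCostAt12G ρ (bc + v0))
  have hinj : Set.InjOn (Torus.proj (L + 1))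
      ((Λ ∪ S₀ ∪ (plaquettesTouching Λ).biUnion plaquetteEdges).image Prod.fst :
        Set (Literature.Probability.LatticeModels.Site 4)) := by
    intro x hx y hy hxy
    obtain ⟨e, he, rfl⟩ := Finset.mem_image.1 (Finset.mem_coe.1 hx)
    obtain ⟨e', he', rfl⟩ := Finset.mem_image.1 (Finset.mem_coe.1 hy)
    exact Literature.Probability.LatticeModels.torusProj_injOn_box hL (fst_mem_box_of_mem_boxUnion he)
      (fst_mem_box_of_mem_boxUnion he') hxy
  -- the DLR equations for the three observables
  have hcpc : Continuous cp := continuous_plaqCostAtG ρ hρ bc 1 2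
  have hcpc' : Continuous cp' := continuous_plaqCostAtG ρ hρ (bc + v0) 1 2
  have hcpK : ∀ U, |cp U| ≤ 2 * N := abs_plaqCostAt_leG ρ hρu bc 1 2
  have hcpK' : ∀ U, |cp' U| ≤ 2 * N := abs_plaqCostAt_leG ρ hρu (bc + v0) 1 2
  have hqc : Continuous fun U => cp U * cp' U := hcpc.mul hcpc'
  have hqK : ∀ U, |cp U * cp' U| ≤ (2 * N) ^ 2 := abs_plaqCostAt_mul_leG ρ hρu bc (bc + v0) 1 2
  have dlr : ∀ {F : LGConfig 4 G → ℝ}, Continuous F → ∀ {C : ℝ}, (∀ U, |F U| ≤ C) → IsCylinder F S₀ →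
      ∫ U, F (torusLift (L + 1) U) ∂(wilsonMeasure (d := 4) (L := L + 1) ρ β) =
        ∫ U, (∫ W, F W ∂(ymSpecification ρ β Λ (torusLift (L + 1) U))) ∂(wilsonMeasure (d := 4) (L := L + 1) ρ β) := by
    intro F hF C hC hFS
    have h := wilsonExpectation_toTorusObservable_eq ρ hρ β Λ hF hC hFS (L := L + 1) hinj
    simpa only [wilsonExpectation, toTorusObservable, Function.comp_def] using h
  -- translation of the origin-based pair to the box centre
  have hpt1 : ∀ W : LGConfig 4 G, cp (configShift bc W) = plaqCost0 ρ 1 2 W := fun W => by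
    simp only [hcp, plaqCostAt, plaqCost0, plaquetteObs, plaquetteHolonomyZd_configShift, sub_self]
  have hpt2 : ∀ W : LGConfig 4 G, cp' (configShift bc W) = plaqCost0 ρ 1 2 (timeShiftLG T W) := fun W => by
    simp only [hcp', plaqCostAt, plaqCost0, plaquetteObs, timeShiftLG, plaquetteHolonomyZd_configShift, hv0,
      add_sub_cancel_left, sub_neg_eq_add, zero_add]
  have e1 : ∫ U, plaqCost0 ρ 1 2 (torusLift (L + 1) U) * plaqCost0 ρ 1 2 (timeShiftLG T (torusLift (L + 1) U))
        ∂(wilsonMeasure (d := 4) (L := L + 1) ρ β) =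
      ∫ U, (∫ W, cp W * cp' W ∂(ymSpecification ρ β Λ (torusLift (L + 1) U))) ∂(wilsonMeasure (d := 4) (L := L + 1) ρ β) := by
    rw [← dlr hqc hqK hcylq, ← integral_comp_configShift_torusLift (S := L + 1) ρ β (fun U => cp U * cp' U) bc]
    simp only [hpt1, hpt2]
  have e2 : ∫ U, plaqCost0 ρ 1 2 (torusLift (L + 1) U) ∂(wilsonMeasure (d := 4) (L := L + 1) ρ β) =
      ∫ U, (∫ W, cp W ∂(ymSpecification ρ β Λ (torusLift (L + 1) U))) ∂(wilsonMeasure (d := 4) (L := L + 1) ρ β) := by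
    rw [← dlr hcpc hcpK hcyl, ← integral_comp_configShift_torusLift (S := L + 1) ρ β cp bc]
    simp only [hpt1]
  have e3 : ∫ U, plaqCost0 ρ 1 2 (timeShiftLG T (torusLift (L + 1) U)) ∂(wilsonMeasure (d := 4) (L := L + 1) ρ β) =
      ∫ U, (∫ W, cp' W ∂(ymSpecification ρ β Λ (torusLift (L + 1) U))) ∂(wilsonMeasure (d := 4) (L := L + 1) ρ β) := by
    rw [← dlr hcpc' hcpK' hcyl', ← integral_comp_configShift_torusLift (S := L + 1) ρ β cp' bc]
    simp only [hpt2]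
  unfold torusPlaqCov wilsonExpectation
  simp only [toTorusObservable_apply]
  rw [e1, e2, e3]

/-! ### §4. A bound on the cold-wall box covariance -/

/-- `boxPlaqCov ρ β H T ≤ 8N²` for a unitary `ρ` of degree `N` (`|c| ≤ 2N`). [folklore] -/
theorem boxPlaqCov_le_sq [SecondCountableTopology G] (hρ : Continuous ρ) (hρu : ∀ g, ρ g ∈ Matrix.unitaryGroup (Fin N) ℂ)
    (β : ℝ) (H T : ℕ) : boxPlaqCov ρ β H T ≤ 8 * (N : ℝ) ^ 2 := by
  have i1 := abs_integral_ymSpecification_le ρ hρ β (AxialGauge.boxEdges 4 (2 * H + 1))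
    (abs_plaqCostAt_mul_leG ρ hρu (boxCentre H) (boxCentre H + Pi.single 0 (T : ℤ)) 1 2) (fun _ => 1)
  have i2 := abs_integral_ymSpecification_le ρ hρ β (AxialGauge.boxEdges 4 (2 * H + 1))
    (abs_plaqCostAt_leG ρ hρu (boxCentre H) 1 2) (fun _ => 1)
  have i3 := abs_integral_ymSpecification_le ρ hρ β (AxialGauge.boxEdges 4 (2 * H + 1))
    (abs_plaqCostAt_leG ρ hρu (boxCentre H + Pi.single 0 (T : ℤ)) 1 2) (fun _ => 1)
  unfold boxPlaqCov boxState
  have hprod := abs_mul (∫ U, plaqCostAt ρ (boxCentre H) 1 2 U ∂(ymSpecification (d := 4) ρ β (AxialGauge.boxEdges 4 (2 * H + 1)) fun _ => 1))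
    (∫ U, plaqCostAt ρ (boxCentre H + Pi.single 0 (T : ℤ)) 1 2 U ∂(ymSpecification (d := 4) ρ β (AxialGauge.boxEdges 4 (2 * H + 1)) fun _ => 1))
  have hN : (0 : ℝ) ≤ 2 * N := by positivity
  have hp2 : |(∫ U, plaqCostAt ρ (boxCentre H) 1 2 U ∂(ymSpecification (d := 4) ρ β (AxialGauge.boxEdges 4 (2 * H + 1)) fun _ => 1)) *
      (∫ U, plaqCostAt ρ (boxCentre H + Pi.single 0 (T : ℤ)) 1 2 U ∂(ymSpecification (d := 4) ρ β (AxialGauge.boxEdges 4 (2 * H + 1)) fun _ => 1))|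
      ≤ 2 * N * (2 * N) := by
    rw [hprod]; exact mul_le_mul i2 i3 (abs_nonneg _) hN
  have a1 := (abs_le.1 i1).2
  have a2 := (abs_le.1 hp2).1
  nlinarith [a1, a2]

end Torus

end Summit.QuantumFields.YangMills.Theorems.ColdBoxAllGroups

end
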